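import Literature.NumberTheory.Automorphic.ChevalleyGroupStructure
import Literature.RepresentationTheory.AlgebraicGroups.Sl2Exponential
import HarnessLib

/-!
# `P` is the root datum of `(G, T_X)` for the group of a family of root matrices
(Springer 10.2.8–10.2.9)

Trunk T-AUTOMORPHIC (G25 AutomorphicL); the group-theoretic half of Chevalley's existence theorem
(`Literature.NumberTheory.Automorphic.chevalley_existence`, Springer, *Linear Algebraic Groups*,
2nd ed., 10.1.1), final step. For `D : RootRep k P b J mb` (`ChevalleyGroupData.lean`) and its
group `D.G = ⟨T_X, U_α⟩` (`ChevalleyGroupBasic.lean`), over an algebraically closed field of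
characteristic `0`, we assemble
**`IsRootDatumOf D.G D.T P eX eY`** (`isRootDatumOf`) with

* `eX = charEquiv : X*(T_X) ≃ X` (`WeightTorus.lean`) and
  `eY : X_*(T_X) ≃ Hom(X, ℤ) ≃ Y` (`cocharEquiv` and the perfect pairing of `P`,
  Mathlib `LinearMap.toPerfPair`);
* `pairing_eq` from `charPairingInt_evalChar_evalCochar` (Springer 3.2.11 (i));
* `range_root` from `range_root_eq_image_roots` (`ChevalleyGroupStructure.lean`);
* `exists_sl2Hom`: the integrable triple `(H_α, E_α, E_{-α})` exponentiates to an algebraic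
  `φ_α : SL₂(k) → G` (`Sl2Exponential.lean`: `IsIntegrableTriple.expRep`) with
  `φ_α (!![1, x; 0, 1]) = exp (x E_α)`, `φ_α (!![1, 0; x, 1]) = exp (x E_{-α})` (root homomorphisms
  for `±α`, `isRootHom_codRestrict_expHom`) and `φ_α (diag (t, t⁻¹)) = α^∨(t)` (both are
  `diag (t ^ ⟨wt a, α^∨⟩)`);

and conclude `exists_isRootDatumOf`: **`(D.G, D.T)` is a connected reductive group with maximal
torus realising the root datum `P`** (Springer 10.2.8–10.2.9 for the adjoint simply-laced case;
here for the root datum of any family of root matrices).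

## References

* [SpringerLAG1998] T. A. Springer, *Linear Algebraic Groups*, 2nd ed. (1998): 3.2.11, 7.3, 8.1.8,
  10.1.1, 10.2.8–10.2.9.
-/

noncomputable section

open scoped MatrixGroups

namespace Literature.NumberTheory.Automorphic

open Literature.RepresentationTheory.AlgebraicGroups.Sl2Exp

variable {k : Type*} [Field k]
variable {ι X Y : Type*} [AddCommGroup X] [AddCommGroup Y]
variable {J : Type*} [Fintype J] [DecidableEq J] {mb : J → Type*} [∀ j, Fintype (mb j)]
  [∀ j, DecidableEq (mb j)]
variable {P : RootPairing ι ℤ X Y} {b : P.Base}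

namespace RootRep

variable (D : RootRep k P b J mb)

local notation "𝕄" => Matrix (Σ j, mb j) (Σ j, mb j) k

/-! ### The cocharacter identification `eY : X_*(T) ≃ Y` -/

section Cochar

variable [Infinite k]

/-- `Y ≃ Hom(X, ℤ)` through the perfect pairing of the root datum. [folklore] -/
def dualYEquiv : Y ≃+ (X →+ ℤ) :=
  (P.toLinearMap.flip.toPerfPair.toAddEquiv).trans (addMonoidHomLequivInt (B := ℤ) ℤ).symm.toAddEquiv

omit [Infinite k] in
/-- The defining property of `dualYEquiv`: `(dualYEquiv.symm f)` pairs with `x` to `f x`.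
[folklore] -/
lemma toLinearMap_dualYEquiv_symm (f : X →+ ℤ) (x : X) :
    P.toLinearMap x ((dualYEquiv (P := P)).symm f) = f x := by
  change P.toLinearMap x (P.toLinearMap.flip.toPerfPair.symm (addMonoidHomLequivInt (B := ℤ) ℤ f)) = f x
  rw [LinearMap.apply_toPerfPair_flip]
  rfl

omit [Infinite k] in
/-- Unfolding of `dualYEquiv`. [folklore] -/
lemma dualYEquiv_apply (y : Y) (x : X) : dualYEquiv (P := P) y x = P.toLinearMap x y := rfl

/-- **The cocharacter identification `eY : X_*(T_X) ≃ Y`** (`X_*(T_X) ≃ Hom(X, ℤ)` by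
`cocharEquiv`, and `Hom(X, ℤ) ≃ Y` by the perfect pairing). [folklore] -/
def eY : Additive ↥(cocharacterLattice D.T) ≃+ Y :=
  (cocharEquiv k D.wt D.wt_surjective).trans (dualYEquiv (P := P)).symm

/-- The cocharacter of `y ∈ Y` is `c ↦ diag (c ^ ⟨wt a, y⟩)`. [folklore] -/
lemma coe_cocharOfCoweight_eY (y : Y) (c : kˣ) :
    ((cocharOfCoweight D.eY y c : ↥D.T) : GL (Σ j, mb j) k) =
      diagonalGL (Σ j, mb j) k (fun a => c ^ P.toLinearMap (D.wt a) y) := by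
  change (((Additive.toMul ((cocharEquiv k D.wt D.wt_surjective).symm
    ((dualYEquiv (P := P)).symm.symm y)) : ↥(cocharacterLattice D.T)) : kˣ →* ↥D.T) c :
      GL (Σ j, mb j) k) = _
  rw [AddEquiv.symm_symm, cocharEquiv_symm_apply, evalCocharHom_apply, toMul_ofMul]
  exact coe_evalCochar_apply D.wt (dualYEquiv (P := P) y) c

/-- **The pairing clause**: `⟨eX χ, eY γ⟩ = ⟨χ, γ⟩` (Springer 3.2.11 (i)).
[cite: SpringerLAG1998, 3.2.11 (i)] -/
theorem pairing_eq [Module.Free ℤ X] [Module.Finite ℤ X] (χ : ↥(characterLattice D.T))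
    (γ : ↥(cocharacterLattice D.T)) :
    P.toLinearMap (D.eX (Additive.ofMul χ)) (D.eY (Additive.ofMul γ)) =
      charPairingInt (χ : ↥D.T →* kˣ) (γ : kˣ →* ↥D.T) := by
  -- write `χ = evalChar x`, `γ = evalCochar y'`
  obtain ⟨x, hx⟩ : ∃ x : X, (charEquiv k D.wt_surjective).symm x = Additive.ofMul χ :=
    ⟨charEquiv k D.wt_surjective (Additive.ofMul χ), AddEquiv.symm_apply_apply _ _⟩
  obtain ⟨y', hy'⟩ : ∃ y' : X →+ ℤ, (cocharEquiv k D.wt D.wt_surjective).symm y' = Additive.ofMul γ :=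
    ⟨cocharEquiv k D.wt D.wt_surjective (Additive.ofMul γ), AddEquiv.symm_apply_apply _ _⟩
  have hχ : (χ : ↥D.T →* kˣ) = evalChar k D.wt_surjective x := by
    rw [charEquiv_symm_apply] at hx
    have h := congrArg (fun z => ((Additive.toMul z : ↥(characterLattice D.T)) : ↥D.T →* kˣ)) hx
    simp only [toMul_ofMul] at h
    rw [← h]
    rfl
  have hγ : (γ : kˣ →* ↥D.T) = evalCochar k D.wt y' := by
    rw [cocharEquiv_symm_apply, evalCocharHom_apply] at hy'
    have h := congrArg (fun z => ((Additive.toMul z : ↥(cocharacterLattice D.T)) : kˣ →* ↥D.T)) hy'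
    simp only [toMul_ofMul] at h
    rw [← h]
    rfl
  have heX : D.eX (Additive.ofMul χ) = x := by
    rw [← hx]; exact AddEquiv.apply_symm_apply _ _
  have heY : D.eY (Additive.ofMul γ) = (dualYEquiv (P := P)).symm y' := by
    rw [← hy']
    change (dualYEquiv (P := P)).symm ((cocharEquiv k D.wt D.wt_surjective)
      ((cocharEquiv k D.wt D.wt_surjective).symm y')) = _
    rw [AddEquiv.apply_symm_apply]
  rw [heX, heY, toLinearMap_dualYEquiv_symm, hχ, hγ]
  exact (charPairingInt_evalChar_evalCochar D.wt D.wt_surjective x y').symm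

end Cochar

/-! ### The `SL₂` of a root -/

section SL2

variable [CharZero k]

/-- The integer `H_α`-weights `⟨wt a, α^∨⟩` of the basis vectors. [folklore] -/
def hWt (i : ι) : (Σ j, mb j) → ℤ := fun a => P.toLinearMap (D.wt a) (P.coroot i)

omit [CharZero k] in
/-- `diag (⟨wt a, α^∨⟩) = H_α`. [folklore] -/
lemma hDiag_hWt (i : ι) : hDiag (k := k) (D.hWt i) = hMat P D.wt i := rfl

/-- **`(H_α, E_α, E_{-α})` is an integrable triple.** [folklore] -/
theorem isIntegrableTriple (i : ι) :
    IsIntegrableTriple (D.hWt i) (D.E i) (D.E (P.reflectionPerm i i)) where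
  lie_h_e := D.hMat_mul_E_sub i
  lie_h_f := D.hMat_mul_E_neg_sub' i
  lie_e_f := D.E_mul_E_neg_sub i
  isNilpotent_e := D.isNilpotent_E i
  isNilpotent_f := D.isNilpotent_E _
  hDiag_ne_zero := D.hMat_ne_zero i

variable [IsAlgClosed k]

/-- The `SL₂` of the root `α` lands in `G`. [folklore] -/
lemma expRep_mem (i : ι) (g : SL(2, k)) : (D.isIntegrableTriple i).expRep g ∈ D.G :=
  (D.isIntegrableTriple i).expRep_mem
    (fun x => by rw [(D.isIntegrableTriple i).expRep_unipotentUpperSL2]; exact D.expHom_mem_G i x)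
    (fun x => by rw [(D.isIntegrableTriple i).expRep_unipotentLowerSL2]; exact D.expHom_mem_G _ x) g

/-- **The homomorphism `φ_α : SL₂(k) → G` of the root `α`.** [folklore] -/
def sl2Hom (i : ι) : SL(2, k) →* ↥D.G :=
  ((D.isIntegrableTriple i).expRep).codRestrict D.G (D.expRep_mem i)

/-- `φ_α` on the upper unipotents is `x ↦ exp (x E_α)`. [folklore] -/
lemma sl2Hom_comp_unipotentUpperSL2 (i : ι) : (D.sl2Hom i).comp unipotentUpperSL2 =
    (expHom (D.E i) (D.isNilpotent_E i)).codRestrict D.G (D.expHom_mem_G i) := by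
  refine MonoidHom.ext fun x => Subtype.ext ?_
  change (D.isIntegrableTriple i).expRep (unipotentUpperSL2 x) = _
  rw [(D.isIntegrableTriple i).expRep_unipotentUpperSL2]
  rfl

/-- `φ_α` on the lower unipotents is `x ↦ exp (x E_{-α})`. [folklore] -/
lemma sl2Hom_comp_unipotentLowerSL2 (i : ι) : (D.sl2Hom i).comp unipotentLowerSL2 =
    (expHom (D.E (P.reflectionPerm i i)) (D.isNilpotent_E _)).codRestrict D.G (D.expHom_mem_G _) := by
  refine MonoidHom.ext fun x => Subtype.ext ?_
  change (D.isIntegrableTriple i).expRep (unipotentLowerSL2 x) = _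
  rw [(D.isIntegrableTriple i).expRep_unipotentLowerSL2]
  rfl

omit [CharZero k] in
/-- The character of the weight `x` under `eX` is `evalChar x`. [folklore] -/
lemma charOfWeight_eX [Module.Free ℤ X] [Module.Finite ℤ X] (x : X) :
    charOfWeight D.eX x = evalChar k D.wt_surjective x := rfl

omit [CharZero k] in
/-- `evalChar (-x) = (evalChar x)⁻¹`. [folklore] -/
lemma charOfWeight_eX_neg [Module.Free ℤ X] [Module.Finite ℤ X] (x : X) :
    charOfWeight D.eX (-x) = (charOfWeight D.eX x)⁻¹ := by
  rw [charOfWeight, charOfWeight, map_neg, toMul_neg, Subgroup.coe_inv]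

/-- **The `exists_sl2Hom` clause for the root `α = P.root i`.** [folklore] -/
theorem sl2Hom_spec [Module.Free ℤ X] [Module.Finite ℤ X] (i : ι) :
    IsAlgebraicSL2Hom (D.sl2Hom i) ∧
    IsRootHom D.G D.T D.T_le_G (charOfWeight D.eX (P.root i)) ((D.sl2Hom i).comp unipotentUpperSL2) ∧
    IsRootHom D.G D.T D.T_le_G (charOfWeight D.eX (P.root i))⁻¹
      ((D.sl2Hom i).comp unipotentLowerSL2) ∧
    ∀ t : kˣ, D.sl2Hom i (diagSL2 t) = Subgroup.inclusion D.T_le_G (cocharOfCoweight D.eY (P.coroot i) t) := by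
  refine ⟨(D.isIntegrableTriple i).isAlgebraicSL2Hom_codRestrict _, ?_, ?_, fun t => ?_⟩
  · rw [sl2Hom_comp_unipotentUpperSL2, charOfWeight_eX]
    exact isRootHom_codRestrict_expHom D.T_le_G (D.isNilpotent_E i) (D.E_ne_zero i) _ (D.conj_E i)
  · rw [sl2Hom_comp_unipotentLowerSL2, ← charOfWeight_eX_neg, ← P.reflection_apply_self,
      ← P.root_reflectionPerm, charOfWeight_eX]
    exact isRootHom_codRestrict_expHom D.T_le_G (D.isNilpotent_E _) (D.E_ne_zero _) _ (D.conj_E _)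
  · apply Subtype.ext
    apply Units.ext
    change (((D.isIntegrableTriple i).expRep (diagSL2 t) : GL (Σ j, mb j) k) : 𝕄) =
      (((cocharOfCoweight D.eY (P.coroot i) t : ↥D.T) : GL (Σ j, mb j) k) : 𝕄)
    rw [(D.isIntegrableTriple i).coe_expRep_diagSL2, coe_cocharOfCoweight_eY, coe_diagonalGL]
    rfl

end SL2

/-! ### `P` is the root datum of `(G, T)` -/

/-- **`P` is the root datum of `(G, T_X)`** through `eX`, `eY` (Springer 10.2.8–10.2.9).
[cite: SpringerLAG1998, Prop 10.2.8] -/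
theorem isRootDatumOf [CharZero k] [IsAlgClosed k] [Finite ι] [Module.Free ℤ X] [Module.Finite ℤ X] :
    IsRootDatumOf D.G D.T P D.eX D.eY where
  le := D.T_le_G
  pairing_eq := D.pairing_eq
  range_root := D.range_root_eq_image_roots
  exists_sl2Hom i := ⟨D.sl2Hom i, D.sl2Hom_spec i⟩

/-- **The group of a family of root matrices realises the root datum**: `D.G` is connected
reductive, `D.T = T_X` is a maximal torus, and `P` is the root datum of `(D.G, D.T)`
(Springer 10.2.8–10.2.9; the group-theoretic half of Chevalley's existence theorem 10.1.1, for
every reduced based root datum admitting a family of root matrices).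
[cite: SpringerLAG1998, Prop 10.2.8 and Cor 10.2.9] -/
theorem exists_isRootDatumOf [CharZero k] [IsAlgClosed k] [Finite ι] [Module.Free ℤ X]
    [Module.Finite ℤ X] :
    ∃ (eX : Additive ↥(characterLattice D.T) ≃+ X) (eY : Additive ↥(cocharacterLattice D.T) ≃+ Y),
      IsConnectedReductive D.G ∧ IsMaximalTorusIn D.T D.G ∧ IsRootDatumOf D.G D.T P eX eY :=
  ⟨D.eX, D.eY, D.isConnectedReductive_G, D.isMaximalTorusIn_T, D.isRootDatumOf⟩

end RootRep

end Literature.NumberTheory.Automorphic
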